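import Summits.Ventures.WeilGRH.ThirdPrimeReflectionRungs
import Summits.RiemannHypothesis.RiemannHypothesis.Theorems.GroundBartaEvenWinsBeyondArchPositivity8046
import HarnessLib

/-!
# GRH arm (rh-explicit, venture WeilGRH): the `ζ` frontier `4023/5000` for characters with `χ(2) = 1`

On the three-prime-power window `log 3 < 2a ≤ log 5` (prime powers `2, 3, 4` inside) a character with
`χ(2) = 1` — hence `χ(4) = χ(2)² = 1` — sees the SAME `n = 2, 4` prime terms as `ζ`, so that
`P_ζ(k) − P_χ(k)` is the single `n = 3` term. Reflecting the prime `3` (`reflection_inequality_at` with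
`L = log 3`; `a ≤ (log 5)/2 < log 3`) then gives the transfer with NO crude term:

`weilPositivityOnChar_transfer_frontier_of_trivial_at_two`: `χ(2) = 1`, `κ₃ = (log 3/√3)‖1 − χ(3)‖ < B ≤ log q`,
Weil positivity for `ζ` on `[-a, a]` and `2·[C_M (B² − κ₃²) + 2B (B·C_A − (log 3/√3)·Re(1 − χ(3))·I_A)] ≤ B(B² − κ₃²)`
(closed forms on `[log 3 − a, a]`) ⟹ `WeilPositivityOnChar χ a`.

At the `ζ` FRONTIER `a = 4023/5000` (`EvenWinsBeyondArch.weilPositivityOn_8046`, the largest kernel-checked `ζ`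
rung): **`WeilPositivityOnChar χ (4023/5000)` for EVERY character `χ` with `χ(2) = 1` of EVERY modulus
`q ≥ 32`**; `q ≥ 24` if moreover `‖1 − χ(3)‖² ≥ 2`; `q ≥ 20` if `‖1 − χ(3)‖² ≥ 3`; `q ≥ 16` if `χ(3) = −1`
(census classes `17.16`; `7.6`, `15.14` stay below). Constants through `e^{4023/5000} ∈ [2.2358019, 2.235802]`:
`C_M ≤ 0.59228`, `C_A ≤ 0.5533`, `I_A ≥ 0.55286`. Margins ≥ 1.9 %.

## References

* A. Weil (1952), (11) and the «lemme» p. 262; H. Yoshida (1992) §6.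
-/

noncomputable section

open Complex Filter Set MeasureTheory
open scoped Real Topology ComplexConjugate ArithmeticFunction.vonMangoldt

namespace Summit.Ventures.WeilGRH

open Literature.NumberTheory.LFunctions

variable {q : ℕ} {g : ℝ → ℂ}

/-! ## The prime difference for `χ(2) = 1` on `[-log 5, log 5]` -/

/-- If `χ(2) = 1` and `tsupport k ⊆ [-log 5, log 5]`, the difference of the `ζ` and `χ` prime terms is
the single `n = 3` term: `n = 2, 4` cancel (`χ(4) = χ(2)² = 1`), `n ≥ 5` is off the open support.
[cite: Weil1952FormulesExplicites, (11) pp. 261–262, prime term] -/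
theorem weilPrimeTerm_sub_weilPrimeTermChar_of_trivial_at_two (χ : DirichletCharacter ℂ q)
    (hχ2 : χ (2 : ZMod q) = 1) {k : ℝ → ℂ} (hk : Continuous k)
    (h : tsupport k ⊆ Icc (-Real.log 5) (Real.log 5)) :
    weilPrimeTerm k - weilPrimeTermChar χ k =
      ((Λ 3 : ℝ) : ℂ) / (Real.sqrt (3 : ℕ) : ℂ) *
        ((1 - χ ((3 : ℕ) : ZMod q)) * k (Real.log (3 : ℕ)) +
          (1 - conj (χ ((3 : ℕ) : ZMod q))) * k (-Real.log (3 : ℕ))) := by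
  have hsupp := support_subset_Ioo_of_tsupport_subset_Icc hk h
  have hχ4 : χ ((4 : ℕ) : ZMod q) = 1 := by
    rw [show ((4 : ℕ) : ZMod q) = 2 * 2 by norm_num, map_mul, hχ2, one_mul]
  have hχ2' : χ ((2 : ℕ) : ZMod q) = 1 := by exact_mod_cast hχ2
  -- termwise difference
  have hterm : ∀ n : ℕ, n ≠ 3 →
      ((Λ n : ℝ) : ℂ) / (Real.sqrt n : ℂ) * (k (Real.log n) + k (-Real.log n)) -
        ((Λ n : ℝ) : ℂ) / (Real.sqrt n : ℂ) *
          (χ (n : ZMod q) * k (Real.log n) + conj (χ (n : ZMod q)) * k (-Real.log n)) = 0 := by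
    intro n hn
    rcases Nat.lt_or_ge n 5 with h5 | h5
    · interval_cases n
      · simp
      · simp
      · rw [hχ2', map_one]; ring
      · exact absurd rfl hn
      · rw [hχ4, map_one]; ring
    · have hlog : Real.log 5 ≤ Real.log n := Real.log_le_log (by norm_num) (by exact_mod_cast h5)
      have h1 : k (Real.log n) = 0 := by
        by_contra hne
        have := (hsupp hne).2
        linarith
      have h2 : k (-Real.log n) = 0 := by
        by_contra hne
        have := (hsupp hne).1
        linarith
      simp [h1, h2]
  have hs1 := summable_weilPrimeTerm (g := k)
    (HasCompactSupport.of_support_subset_isCompact isCompact_Icc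
      ((subset_tsupport k).trans h))
  have hs2 := summable_weilPrimeTermChar χ (g := k)
    (HasCompactSupport.of_support_subset_isCompact isCompact_Icc
      ((subset_tsupport k).trans h))
  unfold weilPrimeTerm weilPrimeTermChar
  rw [← hs1.tsum_sub hs2]
  rw [tsum_eq_single 3 fun n hn ↦ hterm n hn]
  push_cast
  ring

/-- `Re[P_ζ(k) − P_χ(k)] = 2(log 3/√3)·Re[(1 − χ(3)) k(log 3)]` for `χ(2) = 1`, `k = g ⋆ g̃` on `[-log 5, log 5]`.
[cite: Weil1952FormulesExplicites, (11) pp. 261–262, prime term] -/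
theorem re_weilPrimeTerm_sub_weilPrimeTermChar_of_trivial_at_two (χ : DirichletCharacter ℂ q)
    (hχ2 : χ (2 : ZMod q) = 1) (hg : IsWeilTest g)
    (h : tsupport (weilConv g (weilReflect g)) ⊆ Icc (-Real.log 5) (Real.log 5)) :
    (weilPrimeTerm (weilConv g (weilReflect g)) - weilPrimeTermChar χ (weilConv g (weilReflect g))).re =
      2 * (Real.log 3 / Real.sqrt 3) *
        ((1 - χ (3 : ZMod q)) * weilConv g (weilReflect g) (Real.log 3)).re := by
  set k := weilConv g (weilReflect g) with hk
  have hkc : Continuous k := (hg.weilConv hg.weilReflect).1.continuous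
  rw [weilPrimeTerm_sub_weilPrimeTermChar_of_trivial_at_two χ hχ2 hkc h]
  have h3 : ((3 : ℕ) : ZMod q) = 3 := by norm_cast
  have hl3 : Real.log ((3 : ℕ) : ℝ) = Real.log 3 := by norm_num
  have hneg : k (-Real.log 3) = conj (k (Real.log 3)) := by
    rw [hk, ← conj_weilConv_weilReflect_neg g (Real.log 3), Complex.conj_conj]
  have hΛ : ((Λ 3 : ℝ) : ℂ) / (Real.sqrt (3 : ℕ) : ℂ) = ((Real.log 3 / Real.sqrt 3 : ℝ) : ℂ) := by
    rw [ArithmeticFunction.vonMangoldt_apply_prime Nat.prime_three]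
    push_cast
    ring
  rw [h3, hl3, hneg, hΛ]
  set z : ℂ := (1 - χ (3 : ZMod q)) * k (Real.log 3) with hz
  have hsum : (1 - χ (3 : ZMod q)) * k (Real.log 3) +
      (1 - conj (χ (3 : ZMod q))) * conj (k (Real.log 3)) = ((2 * z.re : ℝ) : ℂ) := by
    have : (1 - conj (χ (3 : ZMod q))) * conj (k (Real.log 3)) = conj z := by
      rw [hz, map_mul, map_sub, map_one]
    rw [this, Complex.add_conj, Complex.ofReal_mul, Complex.ofReal_ofNat]
  rw [hsum, ← Complex.ofReal_mul, Complex.ofReal_re]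
  ring

/-! ## The transfer on the three-prime-power window for `χ(2) = 1` -/

/-- **Transfer up to the `ζ` frontier for `χ(2) = 1`.** Let `log 3 < 2a ≤ log 5`, `q ≠ 1`, `χ(2) = 1`,
`κ = (log 3/√3)‖1 − χ(3)‖ < B ≤ log q`, `m = log 3 − a` and `C_M, C_A, I_A` the closed forms on
`[m, a]` reflected at `log 3`. If Weil positivity for `ζ` holds on `[-a, a]` and
`2·[C_M (B² − κ²) + 2B (B·C_A − (log 3/√3)·Re(1 − χ(3))·I_A)] ≤ B (B² − κ²)` then `WeilPositivityOnChar χ a`.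
[cite: Weil1952FormulesExplicites, (11) and the «lemme» p. 262; Yoshida1992 §6] -/
theorem weilPositivityOnChar_transfer_frontier_of_trivial_at_two [NeZero q] {a : ℝ}
    (ha3 : Real.log 3 < 2 * a) (ha5 : 2 * a ≤ Real.log 5) (hζ : WeilPositivityOn a) (hq1 : q ≠ 1)
    (χ : DirichletCharacter ℂ q) (hχ2 : χ (2 : ZMod q) = 1) {B κ : ℝ} (hBq : B ≤ Real.log q)
    (hκ : κ = Real.log 3 / Real.sqrt 3 * ‖1 - χ (3 : ZMod q)‖) (hκB : κ < B)
    {m CM CA IA : ℝ} (hm : m = Real.log 3 - a) (hCM : CM = Real.sinh m + m)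
    (hCA : CA = (Real.sinh a - Real.sinh m + (a - m)) / 2)
    (hIA : IA = (a - m) * Real.cosh (Real.log 3 / 2) / 2 + Real.sinh (a - Real.log 3 / 2))
    (hcrit : 2 * (CM * (B ^ 2 - κ ^ 2) +
        2 * B * (B * CA - Real.log 3 / Real.sqrt 3 * (1 - χ (3 : ZMod q)).re * IA)) ≤
      B * (B ^ 2 - κ ^ 2)) :
    WeilPositivityOnChar χ a := by
  intro g hg hsupp
  set L₃ := Real.log 3 with hL₃
  set k₃ : ℝ := Real.log 3 / Real.sqrt 3 with hk₃
  set u : ℂ := 1 - χ (3 : ZMod q) with hu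
  set r : ℝ := ‖u‖ with hr
  have hk₃0 : 0 < k₃ := div_pos (Real.log_pos (by norm_num)) (by positivity)
  have hr0 : 0 ≤ r := norm_nonneg _
  have hκ0 : 0 ≤ κ := by rw [hκ]; exact mul_nonneg hk₃0.le hr0
  have hB : 0 < B := lt_of_le_of_lt hκ0 hκB
  have ha9 : a ≤ Real.log 3 := by
    have h59 : Real.log 5 ≤ 2 * Real.log 3 := by
      rw [← Real.log_rpow (by norm_num), show ((3 : ℝ) ^ (2 : ℝ)) = 9 by norm_num]
      exact Real.log_le_log (by norm_num) (by norm_num)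
    linarith
  obtain ⟨ω, hω, huω⟩ : ∃ ω : ℂ, ‖ω‖ = 1 ∧ u = (r : ℂ) * ω := by
    by_cases hu0 : u = 0
    · exact ⟨1, by simp, by simp [hr, hu0]⟩
    · have hr' : r ≠ 0 := by rw [hr]; exact norm_ne_zero_iff.2 hu0
      refine ⟨u / (r : ℂ), ?_, ?_⟩
      · rw [norm_div, Complex.norm_real, Real.norm_eq_abs, abs_of_nonneg hr0, hr, div_self]
        exact norm_ne_zero_iff.2 hu0
      · rw [mul_div_cancel₀ _ (by exact_mod_cast hr')]
  have hωre : (r : ℝ) * ω.re = u.re := by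
    rw [huω, Complex.re_ofReal_mul]
  set kL₃ := weilConv g (weilReflect g) L₃ with hkL₃
  set N : ℝ := ∫ x, ‖g x‖ ^ 2 with hN
  set c : ℂ := ∫ x, g x * (Real.cosh (x / 2) : ℂ) with hc
  obtain ⟨hW0, hineq⟩ := reflection_inequality_at hg hsupp ha3 ha9 hω hκ0 hκB hm hCM hCA hIA
  set W : ℝ := B * N + 2 * κ * (ω * kL₃).re with hW
  set G : ℝ := CM / B + (CA + ω.re * IA) / (B + κ) + (CA - ω.re * IA) / (B - κ) with hG
  have hBp : 0 < B + κ := by linarith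
  have hBm : 0 < B - κ := by linarith
  have hκre : κ * ω.re = k₃ * u.re := by
    rw [hκ, ← hωre, hk₃, hr]; ring
  have hGB : G * (B * ((B + κ) * (B - κ))) =
      CM * (B ^ 2 - κ ^ 2) + 2 * B * (B * CA - k₃ * u.re * IA) := by
    rw [hG, ← hκre]
    field_simp
    ring
  have h2G : 2 * G ≤ 1 := by
    have hpos : 0 < B * ((B + κ) * (B - κ)) := by positivity
    refine le_of_mul_le_mul_right ?_ hpos
    calc 2 * G * (B * ((B + κ) * (B - κ))) = 2 * (G * (B * ((B + κ) * (B - κ)))) := by ring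
      _ = 2 * (CM * (B ^ 2 - κ ^ 2) + 2 * B * (B * CA - k₃ * u.re * IA)) := by rw [hGB]
      _ ≤ B * (B ^ 2 - κ ^ 2) := hcrit
      _ = 1 * (B * ((B + κ) * (B - κ))) := by ring
  have hc2 : 2 * ‖c‖ ^ 2 ≤ W := by
    have : ‖c‖ ^ 2 ≤ W * G := hineq
    nlinarith
  have hk : tsupport (weilConv g (weilReflect g)) ⊆ Icc (-Real.log 5) (Real.log 5) :=
    (tsupport_weilConv_weilReflect_subset hg.2 hsupp).trans (Icc_subset_Icc (by linarith) ha5)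
  have hD := re_weilPrimeTerm_sub_weilPrimeTermChar_of_trivial_at_two χ hχ2 hg hk
  have hDW : 2 * κ * (ω * kL₃).re = 2 * k₃ * (u * kL₃).re := by
    rw [huω, mul_assoc (r : ℂ), Complex.re_ofReal_mul, hκ, hk₃, hr]
    ring
  have hmain := re_weilQuadraticChar_ge hq1 χ hg
  have hζg : 0 ≤ (weilQuadratic g).re := hζ g hg hsupp
  have hP := two_mul_re_weilMellin_le hg
  have hN0 : 0 ≤ N := integral_nonneg fun t ↦ by positivity
  have hNB : B * N ≤ N * Real.log q := by
    have h := mul_le_mul_of_nonneg_left hBq hN0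
    rwa [mul_comm N B] at h
  rw [hD] at hmain
  rw [hW, hDW] at hc2
  linarith

/-! ## Numerical constants at the frontier `4023/5000` -/

/-- `2.2358019 ≤ e^{4023/5000} ≤ 2.235802` (Taylor with remainder, 12 terms). [folklore] -/
theorem exp_frontier_bounds :
    (2.2358019 : ℝ) ≤ Real.exp (4023 / 5000) ∧ Real.exp (4023 / 5000) ≤ 2.235802 := by
  have h := Real.exp_bound (x := 4023 / 5000) (by rw [abs_of_nonneg (by norm_num)]; norm_num)
    (n := 12) (by norm_num)
  have hs : (∑ m ∈ Finset.range 12, (4023 / 5000 : ℝ) ^ m / m.factorial) =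
      1 + 4023 / 5000 + (4023 / 5000) ^ 2 / 2 + (4023 / 5000) ^ 3 / 6 + (4023 / 5000) ^ 4 / 24 +
        (4023 / 5000) ^ 5 / 120 + (4023 / 5000) ^ 6 / 720 + (4023 / 5000) ^ 7 / 5040 +
        (4023 / 5000) ^ 8 / 40320 + (4023 / 5000) ^ 9 / 362880 + (4023 / 5000) ^ 10 / 3628800 +
        (4023 / 5000) ^ 11 / 39916800 := by
    simp [Finset.sum_range_succ, Nat.factorial]
  rw [hs, abs_of_nonneg (by norm_num : (0 : ℝ) ≤ 4023 / 5000)] at h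
  norm_num [Nat.factorial] at h
  obtain ⟨h1, h2⟩ := abs_sub_le_iff.1 h
  constructor <;> linarith

/-- The constants of the window `[log 3 − 4023/5000, 4023/5000]`: `C_M ≤ 0.59228`, `C_A ≤ 0.5533`,
`0.55286 ≤ I_A`. [folklore] -/
theorem frontier_constants_three :
    Real.sinh (Real.log 3 - 4023 / 5000) + (Real.log 3 - 4023 / 5000) ≤ 0.59228 ∧
    (Real.sinh (4023 / 5000) - Real.sinh (Real.log 3 - 4023 / 5000) +
        (4023 / 5000 - (Real.log 3 - 4023 / 5000))) / 2 ≤ 0.5533 ∧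
    (0.55286 : ℝ) ≤ (4023 / 5000 - (Real.log 3 - 4023 / 5000)) * Real.cosh (Real.log 3 / 2) / 2 +
        Real.sinh (4023 / 5000 - Real.log 3 / 2) := by
  obtain ⟨ht1, ht2⟩ := sqrt_three_bounds
  obtain ⟨he1, he2⟩ := exp_frontier_bounds
  have hl1 := Real.log_three_gt_d9
  have hl2 := Real.log_three_lt_d9
  set E := Real.exp (4023 / 5000) with hE
  have hE0 : 0 < E := Real.exp_pos _
  have hsq : Real.sqrt 3 * Real.sqrt 3 = 3 := Real.mul_self_sqrt (by norm_num)
  have hs0 : 0 < Real.sqrt 3 := by positivity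
  have he3 : Real.exp (Real.log 3 / 2) = Real.sqrt 3 := by
    rw [Real.sqrt_eq_rpow, Real.rpow_def_of_pos (by norm_num : (0:ℝ) < 3)]; ring_nf
  have hsinh1 : Real.sinh (4023 / 5000) = (E - E⁻¹) / 2 := by
    rw [Real.sinh_eq, Real.exp_neg]
  have hsinh2 : Real.sinh (Real.log 3 - 4023 / 5000) = (3 * E⁻¹ - E / 3) / 2 := by
    rw [Real.sinh_eq, Real.exp_neg, Real.exp_sub, Real.exp_log (by norm_num), ← hE]
    field_simp
  have hsinh3 : Real.sinh (4023 / 5000 - Real.log 3 / 2) = (E / Real.sqrt 3 - Real.sqrt 3 / E) / 2 := by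
    rw [Real.sinh_eq, Real.exp_neg, Real.exp_sub, he3, ← hE]
    field_simp
  have hinv1 : E⁻¹ ≤ 1 / 2.2358019 := by
    rw [inv_eq_one_div]; exact one_div_le_one_div_of_le (by norm_num) he1
  have hinv2 : 1 / 2.235802 ≤ E⁻¹ := by
    rw [inv_eq_one_div]; exact one_div_le_one_div_of_le hE0 he2
  rw [hsinh1, hsinh2, hsinh3, cosh_log_three_half]
  refine ⟨?_, ?_, ?_⟩
  · norm_num at hinv1 ⊢; linarith
  · norm_num at hinv2 ⊢; linarith
  · have hq1 : (2.2358019 : ℝ) / 1.732051 ≤ E / Real.sqrt 3 := by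
      rw [div_le_div_iff₀ (by norm_num) hs0]; nlinarith
    have hq2 : Real.sqrt 3 / E ≤ 1.732051 / 2.2358019 := by
      rw [div_le_div_iff₀ hE0 (by norm_num)]; nlinarith
    norm_num at hq1 hq2 ⊢
    nlinarith

/-! ## The frontier rung for `χ(2) = 1` -/

/-- The frontier rung `4023/5000` for `χ(2) = 1` from the bounded criterion: `1.3 ≤ B ≤ log q`,
`σ₀ ≤ ‖1 − χ(3)‖² ≤ σ₁ ≤ 4`, rational checks at `σ₀, σ₁`.
[cite: Weil1952FormulesExplicites, the «lemme» p. 262; Yoshida1992 §6] -/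
theorem weilPositivityOnChar_frontier_of_curve [NeZero q] (hq1 : q ≠ 1) (χ : DirichletCharacter ℂ q)
    (hχ2 : χ (2 : ZMod q) = 1) {B σ₀ σ₁ : ℝ} (hBq : B ≤ Real.log q) (hB1 : 1.3 ≤ B)
    (hσ₀ : σ₀ ≤ ‖1 - χ (3 : ZMod q)‖ ^ 2) (hσ₁ : ‖1 - χ (3 : ZMod q)‖ ^ 2 ≤ σ₁) (hσ₀0 : 0 ≤ σ₀)
    (hσ₁4 : σ₁ ≤ 4)
    (h0 : 2 * (0.59228 * (B ^ 2 - 0.63428 ^ 2 * σ₀) +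
        2 * B * (B * 0.5533 - 0.63428 * (σ₀ / 2) * 0.55286)) ≤ B * (B ^ 2 - 0.6343 ^ 2 * σ₀))
    (h1 : 2 * (0.59228 * (B ^ 2 - 0.63428 ^ 2 * σ₁) +
        2 * B * (B * 0.5533 - 0.63428 * (σ₁ / 2) * 0.55286)) ≤ B * (B ^ 2 - 0.6343 ^ 2 * σ₁)) :
    WeilPositivityOnChar χ (4023 / 5000) := by
  obtain ⟨hCM, hCA, hIA⟩ := frontier_constants_three
  set k₃ := Real.log 3 / Real.sqrt 3 with hk₃
  set u : ℂ := 1 - χ (3 : ZMod q) with hu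
  have hB : 0 < B := by linarith
  have hsq : (1.69 : ℝ) ≤ B ^ 2 := by nlinarith
  have hk0 : 0 ≤ k₃ := le_trans (by norm_num) kthree_ge
  have hIA0 : (0 : ℝ) ≤ (4023 / 5000 - (Real.log 3 - 4023 / 5000)) * Real.cosh (Real.log 3 / 2) / 2 +
      Real.sinh (4023 / 5000 - Real.log 3 / 2) := by linarith
  have hend : ∀ s : ℝ, 0 ≤ s → s ≤ 4 →
      2 * (0.59228 * (B ^ 2 - 0.63428 ^ 2 * s) +
        2 * B * (B * 0.5533 - 0.63428 * (s / 2) * 0.55286)) ≤ B * (B ^ 2 - 0.6343 ^ 2 * s) →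
      2 * ((Real.sinh (Real.log 3 - 4023 / 5000) + (Real.log 3 - 4023 / 5000)) * (B ^ 2 - k₃ ^ 2 * s) +
        2 * B * (B * ((Real.sinh (4023 / 5000) - Real.sinh (Real.log 3 - 4023 / 5000) +
          (4023 / 5000 - (Real.log 3 - 4023 / 5000))) / 2) -
          k₃ * (s / 2) * ((4023 / 5000 - (Real.log 3 - 4023 / 5000)) * Real.cosh (Real.log 3 / 2) / 2 +
            Real.sinh (4023 / 5000 - Real.log 3 / 2)))) ≤ B * (B ^ 2 - k₃ ^ 2 * s) :=
    fun s hs0 hs4 hnum ↦ reflection_criterion_of_bounds hCM hCA hIA (by norm_num) (by linarith) hs0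
      kthree_ge kthree_le (by norm_num) hB (by norm_num) (by nlinarith [hsq, hs4]) hnum
  have hcrit := reflection_criterion_interpolate (ρ := u.re) hk0 hIA0 hB.le
    (hend σ₀ hσ₀0 (by linarith) h0) (hend σ₁ (by linarith) hσ₁4 h1) hσ₀ hσ₁
    (normSq_one_sub_half_le_re (χ.norm_le_one _))
  have hσ3 : ‖1 - χ (3 : ZMod q)‖ ^ 2 ≤ 4 := by
    have h : ‖1 - χ (3 : ZMod q)‖ ≤ 2 := norm_one_sub_char_three_le χ
    nlinarith [norm_nonneg (1 - χ (3 : ZMod q))]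
  have hl3 := Real.log_three_lt_d9
  have hl5 := Real.log_five_gt_d9
  refine weilPositivityOnChar_transfer_frontier_of_trivial_at_two (B := B) (κ := k₃ * ‖u‖)
    (by linarith) (by linarith)
    Summit.RiemannHypothesis.RiemannHypothesis.Theorems.EvenWinsBeyondArch.weilPositivityOn_8046
    hq1 χ hχ2 hBq (by rw [hk₃, hu]) ?_ rfl rfl rfl rfl ?_
  · have h2 : ‖u‖ ≤ 2 := by nlinarith [hσ3, norm_nonneg u]
    have := mul_le_mul kthree_le h2 (norm_nonneg _) (by norm_num)
    nlinarith [norm_nonneg u]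
  · rw [mul_pow]
    exact hcrit

/-- **THE `ζ` FRONTIER FOR EVERY CHARACTER WITH `χ(2) = 1`, EVERY MODULUS `q ≥ 32`**:
`WeilPositivityOnChar χ (4023/5000)` (`B = 3.465 ≤ 5 log 2`). [cite: Weil1952FormulesExplicites, the «lemme» p. 262; Yoshida1992 §6] -/
theorem weilPositivityOnChar_frontier_of_trivial_at_two (hq : 32 ≤ q) (χ : DirichletCharacter ℂ q)
    (hχ2 : χ (2 : ZMod q) = 1) : WeilPositivityOnChar χ (4023 / 5000) := by
  have hq1 : q ≠ 1 := by omega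
  haveI : NeZero q := ⟨by omega⟩
  have hBq : (3.465 : ℝ) ≤ Real.log q := by
    have h := Real.log_le_log (by norm_num) (by exact_mod_cast hq : (32 : ℝ) ≤ q)
    rw [show (32 : ℝ) = 2 ^ 5 by norm_num, Real.log_pow] at h
    push_cast at h
    linarith [Real.log_two_gt_d9]
  have hσ3 : ‖1 - χ (3 : ZMod q)‖ ^ 2 ≤ 4 := by
    have h : ‖1 - χ (3 : ZMod q)‖ ≤ 2 := norm_one_sub_char_three_le χ
    nlinarith [norm_nonneg (1 - χ (3 : ZMod q))]
  exact weilPositivityOnChar_frontier_of_curve hq1 χ hχ2 hBq (by norm_num)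
    (sq_nonneg _) hσ3 le_rfl le_rfl (by norm_num) (by norm_num)

/-- The frontier rung for `χ(2) = 1`, `‖1 − χ(3)‖² ≥ 2`, `q ≥ 24` (`B = 3.178 ≤ 3 log 2 + log 3`).
[cite: Weil1952FormulesExplicites, the «lemme» p. 262; Yoshida1992 §6] -/
theorem weilPositivityOnChar_frontier_of_trivial_at_two_of_two_le (hq : 24 ≤ q)
    (χ : DirichletCharacter ℂ q) (hχ2 : χ (2 : ZMod q) = 1) (h3 : 2 ≤ ‖1 - χ (3 : ZMod q)‖ ^ 2) :
    WeilPositivityOnChar χ (4023 / 5000) := by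
  have hq1 : q ≠ 1 := by omega
  haveI : NeZero q := ⟨by omega⟩
  have hBq : (3.178 : ℝ) ≤ Real.log q := by
    have h := Real.log_le_log (by norm_num) (by exact_mod_cast hq : (24 : ℝ) ≤ q)
    rw [show (24 : ℝ) = 2 ^ 3 * 3 by norm_num, Real.log_mul (by norm_num) (by norm_num),
      Real.log_pow] at h
    push_cast at h
    linarith [Real.log_two_gt_d9, Real.log_three_gt_d9]
  have hσ3 : ‖1 - χ (3 : ZMod q)‖ ^ 2 ≤ 4 := by
    have h : ‖1 - χ (3 : ZMod q)‖ ≤ 2 := norm_one_sub_char_three_le χ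
    nlinarith [norm_nonneg (1 - χ (3 : ZMod q))]
  exact weilPositivityOnChar_frontier_of_curve hq1 χ hχ2 hBq (by norm_num)
    h3 hσ3 (by norm_num) le_rfl (by norm_num) (by norm_num)

/-- The frontier rung for `χ(2) = 1`, `‖1 − χ(3)‖² ≥ 3`, `q ≥ 20` (`B = 2.995 ≤ 2 log 2 + log 5`).
[cite: Weil1952FormulesExplicites, the «lemme» p. 262; Yoshida1992 §6] -/
theorem weilPositivityOnChar_frontier_of_trivial_at_two_of_three_le (hq : 20 ≤ q)
    (χ : DirichletCharacter ℂ q) (hχ2 : χ (2 : ZMod q) = 1) (h3 : 3 ≤ ‖1 - χ (3 : ZMod q)‖ ^ 2) :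
    WeilPositivityOnChar χ (4023 / 5000) := by
  have hq1 : q ≠ 1 := by omega
  haveI : NeZero q := ⟨by omega⟩
  have hBq : (2.995 : ℝ) ≤ Real.log q := by
    have h := Real.log_le_log (by norm_num) (by exact_mod_cast hq : (20 : ℝ) ≤ q)
    rw [show (20 : ℝ) = 2 ^ 2 * 5 by norm_num, Real.log_mul (by norm_num) (by norm_num),
      Real.log_pow] at h
    push_cast at h
    linarith [Real.log_two_gt_d9, Real.log_five_gt_d9]
  have hσ3 : ‖1 - χ (3 : ZMod q)‖ ^ 2 ≤ 4 := by
    have h : ‖1 - χ (3 : ZMod q)‖ ≤ 2 := norm_one_sub_char_three_le χ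
    nlinarith [norm_nonneg (1 - χ (3 : ZMod q))]
  exact weilPositivityOnChar_frontier_of_curve hq1 χ hχ2 hBq (by norm_num)
    h3 hσ3 (by norm_num) le_rfl (by norm_num) (by norm_num)

/-- The frontier rung for `χ(2) = 1`, `χ(3) = −1`, `q ≥ 16` (`B = 2.7725 ≤ 4 log 2`; class `17.16`).
[cite: Weil1952FormulesExplicites, the «lemme» p. 262; Yoshida1992 §6] -/
theorem weilPositivityOnChar_frontier_of_trivial_at_two_quadratic_at_three (hq : 16 ≤ q)
    (χ : DirichletCharacter ℂ q) (hχ2 : χ (2 : ZMod q) = 1) (h3 : χ (3 : ZMod q) = -1) :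
    WeilPositivityOnChar χ (4023 / 5000) := by
  have hq1 : q ≠ 1 := by omega
  haveI : NeZero q := ⟨by omega⟩
  have hBq : (2.7725 : ℝ) ≤ Real.log q := by
    have h := Real.log_le_log (by norm_num) (by exact_mod_cast hq : (16 : ℝ) ≤ q)
    rw [show (16 : ℝ) = 2 ^ 4 by norm_num, Real.log_pow] at h
    push_cast at h
    linarith [Real.log_two_gt_d9]
  have hσ : ‖1 - χ (3 : ZMod q)‖ ^ 2 = 4 := by rw [h3]; norm_num
  exact weilPositivityOnChar_frontier_of_curve hq1 χ hχ2 hBq (by norm_num)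
    hσ.symm.le hσ.le (by norm_num) le_rfl (by norm_num) (by norm_num)

end Summit.Ventures.WeilGRH
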